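import Summits.QuantumFields.YangMills.Theorems.FlatTubeReductionTransportStepSecondDifference
import HarnessLib

/-!
# The MAGNETIC action on the tube at `u` minus at `1`: the anharmonic remainder's second difference is `O(σ) + O(√σ·τ²) + O(τ_u·τ³)` — no `u`-independent cubic junk
# (route `FlatTubeReduction`, crux K1 `NearFlatRatioLaw` stmt-QuantumFields-24720; seat `ym-line-ftr-p1` g13; rate twin «ratepack-v3 / frozen fibres»; R2b1 RECORD rung — no summit
# statement is proved here)

WHY (memo `Cruxes/NearFlatRatioLaw/Lines/ratepack-v3-frozen-g12.md` §6).  Lane A's two-sided tube expansion `abs_wilsonAction_orthoTube_sub_le`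
(`|S(orthoTube u v) − L³S₁(u) − ‖D_uv̂‖²| ≤ (σ/2)‖D_uv̂‖² + E(τ,σ)`, `E = N_P(1728τ²√σ + 29376τ³ + 700569τ⁴)`) is used in the diagonal Laplace exponent at `u` AND at `1`, so the
cubic junk `N_P·29376τ³` enters `|X − X₁|` twice and never cancels; its Gaussian moment `β·E|v|³ = O(β^{-1/2})` exceeds the rate budget `λ_b² = O(β^{-2/3})`.  Here the two
expansions are SUBTRACTED plaquette by plaquette using `…TransportStepSecondDifference.transportStep_constLift_second_diff`:
* ★ `plaqTerm_constLift_second_diff` — per plaquette, the valley-grade remainder at `U = constLift u` minus the one at `U = 1` is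
  `≤ 1728τ²√σ + (σ/2)(29376τ³ + 700569τ⁴) + 700000·t·τ³` (every term carries `σ`, `√σ` or `t`; `σ ≥ L³S₁(u) = O(t⁴)`);
* ★★ `abs_wilsonAction_orthoTube_second_diff` — for `v ∈ capBalancedSet L`, `|v_{e,c}| ≤ τ ≤ 1/30`, `L³S₁(u) ≤ σ < 2`, `|u⃗_{k,a}| ≤ t ≤ 1/40`:
  `|[S(orthoTube u v) − L³S₁(u) − ‖D_u v̂‖²] − [S(orthoTube 1 v) − ‖D_1 v̂‖²]| ≤ (σ/2)‖D_u v̂‖² + N_P(1728τ²√σ + (σ/2)(29376τ³ + 700569τ⁴) + 700000·t·τ³)`.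
HONEST FRAMING: fixed-lattice algebra on top of lane A/B's exact step identities; femto rung R2b1 (RECORD label); not infinite volume, not a gap, not Clay.  No defs, no named facts,
no `sorry`.
-/

set_option autoImplicit false

noncomputable section

open scoped Matrix BigOperators InnerProductSpace RealInnerProductSpace
open Literature.MathematicalPhysics.QuantumFieldTheory
open Literature.MathematicalPhysics.QuantumLattice

namespace Summit.QuantumFields.YangMills.Theorems.FemtoTransferGap.RateTube

open Summit.QuantumFields.YangMills.Theorems.FemtoTransferGap
open Summit.QuantumFields.YangMills.Theorems.FemtoTransferGap.TwoLattice
open Summit.QuantumFields.YangMills.Theorems.FemtoTransferGap.TwoLattice.Stiff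
open Summit.QuantumFields.YangMills.Theorems.FemtoTransferGap.TwoLattice.Cov
open Summit.QuantumFields.YangMills.Theorems.FemtoTransferGap.TwoLattice.ConstTube
open Summit.QuantumFields.YangMills.Theorems.FemtoTransferGap.TwoLattice.Toron

variable {L : ℕ} [NeZero L]

/-! ## §1 ★ Per plaquette -/

set_option maxHeartbeats 800000 in
/-- ★ **Per-plaquette second difference of the valley-grade remainder.**  With `X = X_p(W;U)`, `c_p = u₀(hol_p U)`, `D = (D_U w)_p`, `F = F_p(U)` and
`T(U) := [2(1 − u₀X)c_p + 2·vecX·vecF… ] − 2Σ_c D_cF_c − c_pΣ_c D_c²` (the summand of `abs_wilsonAction_step_sub_quadratic_le`), for `U = constLift u` versus `U = 1`: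
`|T(constLift u) − T(1)| ≤ 1728τ²√σ + (σ/2)(29376τ³ + 700569τ⁴) + 700000·t·τ³`. [cite: Luscher1983, §3] -/
theorem plaqTerm_constLift_second_diff (u : GaugeConfig 3 1 SU2) (W : GaugeConfig 3 L SU2) {τ σ t : ℝ} (hτ : τ ≤ 1 / 30) (hσ : σ < 2) (ht : t ≤ 1 / 40)
    (hS : (L : ℝ) ^ 3 * wilsonAction su2Rep u ≤ σ) (hs : ∀ e : Edge 3 L, 0 ≤ scalarPart (W e)) (hw : ∀ (e : Edge 3 L) (c : Fin 3), |vecPart (W e) c| ≤ τ)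
    (hu : ∀ (k : Fin 3) (a : Fin 3), |vecPart (u (0, k)) a| ≤ t) (p : Plaquette 3 L) :
    |((2 * (1 - scalarPart (transportStep W (constLift L u) p)) * scalarPart (hol (constLift L u) p) +
          2 * (vecPart (transportStep W (constLift L u) p) ⬝ᵥ vecPart (hol (constLift L u) p)))
        - 2 * ∑ c, covCurl (constLift L u) (linkVec L W) (p, c) * plaqCurv (constLift L u) (p, c)
        - scalarPart (hol (constLift L u) p) * ∑ c, covCurl (constLift L u) (linkVec L W) (p, c) ^ 2)
      - ((2 * (1 - scalarPart (transportStep W 1 p)) * scalarPart (hol 1 p) + 2 * (vecPart (transportStep W 1 p) ⬝ᵥ vecPart (hol 1 p)))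
        - 2 * ∑ c, covCurl 1 (linkVec L W) (p, c) * plaqCurv 1 (p, c)
        - scalarPart (hol 1 p) * ∑ c, covCurl 1 (linkVec L W) (p, c) ^ 2)| ≤
      1728 * τ ^ 2 * Real.sqrt σ + σ / 2 * (29376 * τ ^ 3 + 700569 * τ ^ 4) + 700000 * t * τ ^ 3 := by
  have hτ0 : 0 ≤ τ := (abs_nonneg _).trans (hw ((0 : Site 3 L), 0) 0)
  have ht0 : 0 ≤ t := (abs_nonneg _).trans (hu 0 0)
  have hσ0 : 0 ≤ σ := le_trans (mul_nonneg (by positivity) (wilsonAction_su2_nonneg u)) hS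
  have hS' : wilsonAction su2Rep (constLift L u) ≤ σ := by rw [wilsonAction_constLift_eq]; exact hS
  set U := constLift L u with hU
  -- data at `U`
  obtain ⟨dX, bX, sX, aX⟩ := transportStep_bounds W U hτ hs hw p
  obtain ⟨hH, hF⟩ := hol_hypotheses_of_wilsonAction_le U hσ hS' p
  -- data at `1`
  obtain ⟨dX0, bX0, sX0, aX0⟩ := transportStep_bounds W (1 : GaugeConfig 3 L SU2) hτ hs hw p
  have hhol1 : hol (1 : GaugeConfig 3 L SU2) p = 1 := by simp [hol, plaquetteHolonomy]
  have hs1 : scalarPart (1 : SU2) = 1 := by rw [scalarPart_eq]; simp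
  have hv1 : vecPart (1 : SU2) = 0 := by ext a; fin_cases a <;> simp
  have hF1 : ∀ c, plaqCurv (1 : GaugeConfig 3 L SU2) (p, c) = 0 := fun c => by rw [plaqCurv_apply, hhol1, hv1, Pi.zero_apply]
  -- second differences of the transported step
  obtain ⟨R, S, Dd⟩ := transportStep_constLift_second_diff u W hτ ht hs hw hu p
  -- abbreviations
  set X := transportStep W U p with hXdef
  set X0 := transportStep W 1 p with hX0def
  set cp := scalarPart (hol U p) with hcp
  have hcp1 : cp ≤ 1 := by
    have h := scalarPart_sq_add (hol U p)
    have h2 : 0 ≤ ∑ a, vecPart (hol U p) a ^ 2 := Finset.sum_nonneg fun a _ => sq_nonneg _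
    nlinarith
  have hcpσ : 1 - σ / 2 ≤ cp := one_sub_half_le_scalarPart_hol U hS' p
  have hDb : ∀ c, |covCurl U (linkVec L W) (p, c)| ≤ 10 * τ := fun c => abs_covCurl_apply_le U (w := linkVec L W) (fun e b => by rw [linkVec_apply]; exact hw e b) (p, c)
  have hD0b : ∀ c, |covCurl 1 (linkVec L W) (p, c)| ≤ 10 * τ := fun c => abs_covCurl_apply_le 1 (w := linkVec L W) (fun e b => by rw [linkVec_apply]; exact hw e b) (p, c)
  -- rewrite both plaquette terms in lane A's split form
  have hquad : 2 * (1 - scalarPart X) = ∑ c, vecPart X c ^ 2 + (1 - scalarPart X) ^ 2 := two_mul_one_sub_scalarPart_eq X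
  have hquad0 : 2 * (1 - scalarPart X0) = ∑ c, vecPart X0 c ^ 2 + (1 - scalarPart X0) ^ 2 := two_mul_one_sub_scalarPart_eq X0
  have hsplit : ((2 * (1 - scalarPart X) * cp + 2 * (vecPart X ⬝ᵥ vecPart (hol U p))) - 2 * ∑ c, covCurl U (linkVec L W) (p, c) * plaqCurv U (p, c) - cp * ∑ c, covCurl U (linkVec L W) (p, c) ^ 2)
      - ((2 * (1 - scalarPart X0) * scalarPart (hol 1 p) + 2 * (vecPart X0 ⬝ᵥ vecPart (hol 1 p))) - 2 * ∑ c, covCurl 1 (linkVec L W) (p, c) * plaqCurv 1 (p, c)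
        - scalarPart (hol 1 p) * ∑ c, covCurl 1 (linkVec L W) (p, c) ^ 2) =
      (cp - 1) * (∑ c, vecPart X c ^ 2 - ∑ c, covCurl U (linkVec L W) (p, c) ^ 2) + ((∑ c, vecPart X c ^ 2 - ∑ c, covCurl U (linkVec L W) (p, c) ^ 2) - (∑ c, vecPart X0 c ^ 2 - ∑ c, covCurl 1 (linkVec L W) (p, c) ^ 2))
        + (cp - 1) * (1 - scalarPart X) ^ 2 + ((1 - scalarPart X) ^ 2 - (1 - scalarPart X0) ^ 2)
        + 2 * (vecPart X ⬝ᵥ vecPart (hol U p) - ∑ c, covCurl U (linkVec L W) (p, c) * plaqCurv U (p, c)) := by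
    rw [hhol1, hs1, hv1, hquad, hquad0]
    simp only [hF1, mul_zero, Finset.sum_const_zero, dotProduct_zero, sub_zero, add_zero, one_mul]
    ring
  rw [hsplit]
  -- (a) lane A's cubic bound at `U`
  have hsq : |∑ c, vecPart X c ^ 2 - ∑ c, covCurl U (linkVec L W) (p, c) ^ 2| ≤ 29376 * τ ^ 3 := by
    rw [← Finset.sum_sub_distrib]
    have hc : ∀ c, |vecPart X c ^ 2 - covCurl U (linkVec L W) (p, c) ^ 2| ≤ 288 * τ ^ 2 * (34 * τ) := fun c => by
      have e : vecPart X c ^ 2 - covCurl U (linkVec L W) (p, c) ^ 2 = (vecPart X c - covCurl U (linkVec L W) (p, c)) * (vecPart X c + covCurl U (linkVec L W) (p, c)) := by ring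
      rw [e, abs_mul]
      refine mul_le_mul (dX c) ((abs_add_le _ _).trans (by linarith [bX c, hDb c])) (abs_nonneg _) (by positivity)
    calc |∑ c, (vecPart X c ^ 2 - covCurl U (linkVec L W) (p, c) ^ 2)| ≤ ∑ c, |vecPart X c ^ 2 - covCurl U (linkVec L W) (p, c) ^ 2| := Finset.abs_sum_le_sum_abs _ _
      _ ≤ ∑ _c : Fin 3, 288 * τ ^ 2 * (34 * τ) := Finset.sum_le_sum fun c _ => hc c
      _ = 29376 * τ ^ 3 := by simp; ring
  have t1 : |(cp - 1) * (∑ c, vecPart X c ^ 2 - ∑ c, covCurl U (linkVec L W) (p, c) ^ 2)| ≤ σ / 2 * (29376 * τ ^ 3) := by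
    rw [abs_mul]
    refine mul_le_mul ?_ hsq (abs_nonneg _) (by linarith)
    rw [abs_sub_comm, abs_of_nonneg (by linarith)]; linarith
  -- (b) the NEW second difference of the cubic term
  have t2 : |(∑ c, vecPart X c ^ 2 - ∑ c, covCurl U (linkVec L W) (p, c) ^ 2) - (∑ c, vecPart X0 c ^ 2 - ∑ c, covCurl 1 (linkVec L W) (p, c) ^ 2)| ≤ 501531 * t * τ ^ 3 := by
    rw [← Finset.sum_sub_distrib, ← Finset.sum_sub_distrib, ← Finset.sum_sub_distrib]
    have hc : ∀ c, |(vecPart X c ^ 2 - covCurl U (linkVec L W) (p, c) ^ 2) - (vecPart X0 c ^ 2 - covCurl 1 (linkVec L W) (p, c) ^ 2)| ≤ 167177 * t * τ ^ 3 := fun c => by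
      -- `e = vecX − D`, `x² − D² = e(2D + e)`
      have e1 : (vecPart X c ^ 2 - covCurl U (linkVec L W) (p, c) ^ 2) - (vecPart X0 c ^ 2 - covCurl 1 (linkVec L W) (p, c) ^ 2) =
          ((vecPart X c - covCurl U (linkVec L W) (p, c)) - (vecPart X0 c - covCurl 1 (linkVec L W) (p, c))) * (2 * covCurl U (linkVec L W) (p, c) + (vecPart X c - covCurl U (linkVec L W) (p, c))) +
            (vecPart X0 c - covCurl 1 (linkVec L W) (p, c)) * (2 * (covCurl U (linkVec L W) (p, c) - covCurl 1 (linkVec L W) (p, c)) + ((vecPart X c - covCurl U (linkVec L W) (p, c)) - (vecPart X0 c - covCurl 1 (linkVec L W) (p, c)))) := by ring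
      rw [e1]
      have hR := R c
      have hDd := Dd c
      have he := dX c
      have he0 := dX0 c
      have hτ2 : τ ^ 2 ≤ τ / 30 := by nlinarith
      have u1 : |((vecPart X c - covCurl U (linkVec L W) (p, c)) - (vecPart X0 c - covCurl 1 (linkVec L W) (p, c))) * (2 * covCurl U (linkVec L W) (p, c) + (vecPart X c - covCurl U (linkVec L W) (p, c)))| ≤ 3339 * t * τ ^ 2 * (20 * τ + 288 * τ ^ 2) := by
        rw [abs_mul]
        refine mul_le_mul hR ((abs_add_le _ _).trans ?_) (abs_nonneg _) (by positivity)
        rw [abs_mul, abs_two]; linarith [hDb c]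
      have u2 : |(vecPart X0 c - covCurl 1 (linkVec L W) (p, c)) * (2 * (covCurl U (linkVec L W) (p, c) - covCurl 1 (linkVec L W) (p, c)) + ((vecPart X c - covCurl U (linkVec L W) (p, c)) - (vecPart X0 c - covCurl 1 (linkVec L W) (p, c))))| ≤
          288 * τ ^ 2 * (2 * (63 * t * τ) + 3339 * t * τ ^ 2) := by
        rw [abs_mul]
        refine mul_le_mul he0 ((abs_add_le _ _).trans ?_) (abs_nonneg _) (by positivity)
        rw [abs_mul, abs_two]; linarith
      have := abs_add_le (((vecPart X c - covCurl U (linkVec L W) (p, c)) - (vecPart X0 c - covCurl 1 (linkVec L W) (p, c))) * (2 * covCurl U (linkVec L W) (p, c) + (vecPart X c - covCurl U (linkVec L W) (p, c))))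
        ((vecPart X0 c - covCurl 1 (linkVec L W) (p, c)) * (2 * (covCurl U (linkVec L W) (p, c) - covCurl 1 (linkVec L W) (p, c)) + ((vecPart X c - covCurl U (linkVec L W) (p, c)) - (vecPart X0 c - covCurl 1 (linkVec L W) (p, c)))))
      have httτ : 0 ≤ t * τ ^ 3 := by positivity
      nlinarith [mul_le_mul_of_nonneg_left hτ2 (by positivity : (0 : ℝ) ≤ t * τ ^ 2)]
    calc |∑ c, ((vecPart X c ^ 2 - covCurl U (linkVec L W) (p, c) ^ 2) - (vecPart X0 c ^ 2 - covCurl 1 (linkVec L W) (p, c) ^ 2))| ≤ ∑ c, |(vecPart X c ^ 2 - covCurl U (linkVec L W) (p, c) ^ 2) - (vecPart X0 c ^ 2 - covCurl 1 (linkVec L W) (p, c) ^ 2)| :=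
          Finset.abs_sum_le_sum_abs _ _
      _ ≤ ∑ _c : Fin 3, 167177 * t * τ ^ 3 := Finset.sum_le_sum fun c _ => hc c
      _ = 501531 * t * τ ^ 3 := by simp; ring
  -- (c) the quartic terms
  have hX1 : 0 ≤ 1 - scalarPart X := by
    have h := scalarPart_sq_add X
    have h2 : 0 ≤ ∑ a, vecPart X a ^ 2 := Finset.sum_nonneg fun a _ => sq_nonneg _
    nlinarith
  have hX01 : 0 ≤ 1 - scalarPart X0 := by
    have h := scalarPart_sq_add X0
    have h2 : 0 ≤ ∑ a, vecPart X0 a ^ 2 := Finset.sum_nonneg fun a _ => sq_nonneg _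
    nlinarith
  have httτ : 0 ≤ t * τ ^ 3 := by positivity
  have t3 : |(cp - 1) * (1 - scalarPart X) ^ 2| ≤ σ / 2 * (700569 * τ ^ 4) := by
    rw [abs_mul, abs_of_nonneg (sq_nonneg (1 - scalarPart X)), abs_sub_comm cp 1, abs_of_nonneg (by linarith : (0 : ℝ) ≤ 1 - cp)]
    refine mul_le_mul (by linarith) ?_ (sq_nonneg _) (by linarith)
    calc (1 - scalarPart X) ^ 2 ≤ (837 * τ ^ 2) ^ 2 := pow_le_pow_left₀ hX1 aX 2
      _ = 700569 * τ ^ 4 := by ring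
  have t4 : |(1 - scalarPart X) ^ 2 - (1 - scalarPart X0) ^ 2| ≤ 189832 * t * τ ^ 3 := by
    have e : (1 - scalarPart X) ^ 2 - (1 - scalarPart X0) ^ 2 = (scalarPart X0 - scalarPart X) * ((1 - scalarPart X) + (1 - scalarPart X0)) := by ring
    rw [e, abs_mul, abs_of_nonneg (by linarith : (0 : ℝ) ≤ (1 - scalarPart X) + (1 - scalarPart X0))]
    have hS' : |scalarPart X0 - scalarPart X| ≤ 3402 * t * τ ^ 2 := by rw [abs_sub_comm]; exact S
    have hτ2 : τ ^ 4 ≤ τ ^ 3 / 30 := by nlinarith [pow_nonneg hτ0 3]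
    have hτ2t := mul_le_mul_of_nonneg_left hτ2 ht0
    calc |scalarPart X0 - scalarPart X| * ((1 - scalarPart X) + (1 - scalarPart X0)) ≤ 3402 * t * τ ^ 2 * (837 * τ ^ 2 + 837 * τ ^ 2) :=
          mul_le_mul hS' (add_le_add aX aX0) (by linarith) (by positivity)
      _ = 5694948 * (t * τ ^ 4) := by ring
      _ ≤ 5694948 * (t * (τ ^ 3 / 30)) := by gcongr
      _ ≤ 189832 * t * τ ^ 3 := by linarith
  -- (d) the linear cross term (lane A)
  have t5 : |2 * (vecPart X ⬝ᵥ vecPart (hol U p) - ∑ c, covCurl U (linkVec L W) (p, c) * plaqCurv U (p, c))| ≤ 1728 * τ ^ 2 * Real.sqrt σ := by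
    have e : vecPart X ⬝ᵥ vecPart (hol U p) - ∑ c, covCurl U (linkVec L W) (p, c) * plaqCurv U (p, c) = (fun c => vecPart X c - covCurl U (linkVec L W) (p, c)) ⬝ᵥ vecPart (hol U p) := by
      simp only [dotProduct, plaqCurv_apply, ← Finset.sum_sub_distrib]
      exact Finset.sum_congr rfl fun c _ => by ring
    rw [abs_mul, abs_two, e]
    have h := abs_dot_le dX hF
    linarith
  -- assemble
  have s1 := abs_add_le ((cp - 1) * (∑ c, vecPart X c ^ 2 - ∑ c, covCurl U (linkVec L W) (p, c) ^ 2) + ((∑ c, vecPart X c ^ 2 - ∑ c, covCurl U (linkVec L W) (p, c) ^ 2) - (∑ c, vecPart X0 c ^ 2 - ∑ c, covCurl 1 (linkVec L W) (p, c) ^ 2))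
        + (cp - 1) * (1 - scalarPart X) ^ 2 + ((1 - scalarPart X) ^ 2 - (1 - scalarPart X0) ^ 2))
    (2 * (vecPart X ⬝ᵥ vecPart (hol U p) - ∑ c, covCurl U (linkVec L W) (p, c) * plaqCurv U (p, c)))
  have s2 := abs_add_le ((cp - 1) * (∑ c, vecPart X c ^ 2 - ∑ c, covCurl U (linkVec L W) (p, c) ^ 2) + ((∑ c, vecPart X c ^ 2 - ∑ c, covCurl U (linkVec L W) (p, c) ^ 2) - (∑ c, vecPart X0 c ^ 2 - ∑ c, covCurl 1 (linkVec L W) (p, c) ^ 2))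
        + (cp - 1) * (1 - scalarPart X) ^ 2) ((1 - scalarPart X) ^ 2 - (1 - scalarPart X0) ^ 2)
  have s3 := abs_add_le ((cp - 1) * (∑ c, vecPart X c ^ 2 - ∑ c, covCurl U (linkVec L W) (p, c) ^ 2) + ((∑ c, vecPart X c ^ 2 - ∑ c, covCurl U (linkVec L W) (p, c) ^ 2) - (∑ c, vecPart X0 c ^ 2 - ∑ c, covCurl 1 (linkVec L W) (p, c) ^ 2)))
    ((cp - 1) * (1 - scalarPart X) ^ 2)
  have s4 := abs_add_le ((cp - 1) * (∑ c, vecPart X c ^ 2 - ∑ c, covCurl U (linkVec L W) (p, c) ^ 2)) ((∑ c, vecPart X c ^ 2 - ∑ c, covCurl U (linkVec L W) (p, c) ^ 2) - (∑ c, vecPart X0 c ^ 2 - ∑ c, covCurl 1 (linkVec L W) (p, c) ^ 2))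
  linarith


/-! ## §2 ★★ The Wilson action on the tube: `u` versus `1` -/

set_option maxHeartbeats 800000 in
/-- ★★ **THE TUBE'S MAGNETIC REMAINDER AT `u` MINUS AT `1`.**  For `v ∈ capBalancedSet L` with `|v_{e,c}| ≤ τ ≤ 1/30`, `L³S₁(u) ≤ σ < 2` and `|u⃗_{k,a}| ≤ t ≤ 1/40`:
`|[S(orthoTube u v) − L³S₁(u) − ‖D_u v̂‖²] − [S(orthoTube 1 v) − ‖D_1 v̂‖²]| ≤ (σ/2)‖D_u v̂‖² + N_P·(1728τ²√σ + (σ/2)(29376τ³ + 700569τ⁴) + 700000·t·τ³)` — compare lane A's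
`abs_wilsonAction_orthoTube_sub_le` at `u` plus at `1`, whose sum carries the `u`-independent `2N_P(29376τ³ + 700569τ⁴)`. [cite: Luscher1983, §3] -/
theorem abs_wilsonAction_orthoTube_second_diff (u : GaugeConfig 3 1 SU2) {v : Edge 3 L → Fin 3 → ℝ} (hv : v ∈ capBalancedSet L)
    {τ σ t : ℝ} (hτ : τ ≤ 1 / 30) (hσ : σ < 2) (ht : t ≤ 1 / 40) (hS : (L : ℝ) ^ 3 * wilsonAction su2Rep u ≤ σ)
    (hvτ : ∀ (e : Edge 3 L) (c : Fin 3), |v e c| ≤ τ) (hu : ∀ (k : Fin 3) (a : Fin 3), |vecPart (u (0, k)) a| ≤ t) :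
    |(wilsonAction su2Rep (orthoTube L u v) - (L : ℝ) ^ 3 * wilsonAction su2Rep u - ‖covCurl (constLift L u) (linkEmbed L v)‖ ^ 2) -
        (wilsonAction su2Rep (orthoTube L 1 v) - ‖covCurl (1 : GaugeConfig 3 L SU2) (linkEmbed L v)‖ ^ 2)| ≤
      σ / 2 * ‖covCurl (constLift L u) (linkEmbed L v)‖ ^ 2 +
        (Fintype.card (Plaquette 3 L) : ℝ) * (1728 * τ ^ 2 * Real.sqrt σ + σ / 2 * (29376 * τ ^ 3 + 700569 * τ ^ 4) + 700000 * t * τ ^ 3) := by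
  have hv1 : ∀ e : Edge 3 L, ∑ a, v e a ^ 2 ≤ 1 := sum_sq_le_one_of_cap L hv.2
  have hσ0 : 0 ≤ σ := le_trans (mul_nonneg (by positivity) (wilsonAction_su2_nonneg u)) hS
  set W : GaugeConfig 3 L SU2 := fun e => chartSU2 (v e) with hWdef
  set U := constLift L u with hU
  have hS' : wilsonAction su2Rep U ≤ σ := by rw [hU, wilsonAction_constLift_eq]; exact hS
  have hs : ∀ e : Edge 3 L, 0 ≤ scalarPart (W e) := fun e => by
    show 0 ≤ scalarPart (chartSU2 (v e)); rw [scalarPart_chartSU2 (hv1 e)]; exact Real.sqrt_nonneg _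
  have hw : ∀ (e : Edge 3 L) (c : Fin 3), |vecPart (W e) c| ≤ τ := fun e c => by
    show |vecPart (chartSU2 (v e)) c| ≤ τ; rw [vecPart_chartSU2 (hv1 e)]; exact hvτ e c
  have hWv : linkVec L W = linkEmbed L v := linkVec_chartSU2_eq_linkEmbed hv1
  -- the tube as a step
  have hTu : orthoTube L u v = W * U := orthoTube_eq_mul_constLift L u v
  have hT1 : orthoTube L 1 v = W * 1 := by rw [orthoTube_eq_mul_constLift, constLift_one']
  have hSU : wilsonAction su2Rep U = (L : ℝ) ^ 3 * wilsonAction su2Rep u := wilsonAction_constLift_eq u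
  have hS1 : wilsonAction su2Rep (1 : GaugeConfig 3 L SU2) = 0 := wilsonAction_one_eq_zero su2Rep
  -- exact increments
  have hincU := wilsonAction_step_eq W U
  have hinc1 := wilsonAction_step_eq W (1 : GaugeConfig 3 L SU2)
  -- no linear term (balance), at `U` and at `1`
  have hlinU : ∑ p : Plaquette 3 L, ∑ c, covCurl U (linkVec L W) (p, c) * plaqCurv U (p, c) = 0 := by
    rw [sum_covCurl_mul_plaqCurv_eq_inner, hWv, hU]; exact inner_covCurl_linkEmbed_plaqCurv_constLift_eq_zero u hv.1
  have hlin1 : ∑ p : Plaquette 3 L, ∑ c, covCurl (1 : GaugeConfig 3 L SU2) (linkVec L W) (p, c) * plaqCurv 1 (p, c) = 0 := by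
    rw [sum_covCurl_mul_plaqCurv_eq_inner, hWv]
    have h := inner_covCurl_linkEmbed_plaqCurv_constLift_eq_zero (L := L) (1 : GaugeConfig 3 1 SU2) hv.1
    rwa [constLift_one'] at h
  -- the weighted stiffness at `U` and at `1`
  have hwU := weighted_stiffness_bounds U hS' (linkVec L W)
  have hhol1 : ∀ p : Plaquette 3 L, hol (1 : GaugeConfig 3 L SU2) p = 1 := fun p => by simp [hol, plaquetteHolonomy]
  have hs1 : scalarPart (1 : SU2) = 1 := by rw [scalarPart_eq]; simp
  have hw1 : ∑ p : Plaquette 3 L, scalarPart (hol (1 : GaugeConfig 3 L SU2) p) * ∑ c, covCurl (1 : GaugeConfig 3 L SU2) (linkVec L W) (p, c) ^ 2 =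
      ‖covCurl (1 : GaugeConfig 3 L SU2) (linkVec L W)‖ ^ 2 := by
    rw [← sum_covCurl_sq_eq_norm_sq]
    exact Finset.sum_congr rfl fun p _ => by rw [hhol1, hs1, one_mul]
  -- per-plaquette second differences, summed
  have key := fun p : Plaquette 3 L => plaqTerm_constLift_second_diff u W hτ hσ ht hS hs hw hu p
  have hsum : |∑ p : Plaquette 3 L,
      (((2 * (1 - scalarPart (transportStep W U p)) * scalarPart (hol U p) + 2 * (vecPart (transportStep W U p) ⬝ᵥ vecPart (hol U p)))
        - 2 * ∑ c, covCurl U (linkVec L W) (p, c) * plaqCurv U (p, c) - scalarPart (hol U p) * ∑ c, covCurl U (linkVec L W) (p, c) ^ 2)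
      - ((2 * (1 - scalarPart (transportStep W 1 p)) * scalarPart (hol 1 p) + 2 * (vecPart (transportStep W 1 p) ⬝ᵥ vecPart (hol 1 p)))
        - 2 * ∑ c, covCurl 1 (linkVec L W) (p, c) * plaqCurv 1 (p, c) - scalarPart (hol 1 p) * ∑ c, covCurl 1 (linkVec L W) (p, c) ^ 2))| ≤
      (Fintype.card (Plaquette 3 L) : ℝ) * (1728 * τ ^ 2 * Real.sqrt σ + σ / 2 * (29376 * τ ^ 3 + 700569 * τ ^ 4) + 700000 * t * τ ^ 3) := by
    refine (Finset.abs_sum_le_sum_abs _ _).trans ?_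
    calc ∑ p : Plaquette 3 L, |(((2 * (1 - scalarPart (transportStep W U p)) * scalarPart (hol U p) + 2 * (vecPart (transportStep W U p) ⬝ᵥ vecPart (hol U p)))
        - 2 * ∑ c, covCurl U (linkVec L W) (p, c) * plaqCurv U (p, c) - scalarPart (hol U p) * ∑ c, covCurl U (linkVec L W) (p, c) ^ 2)
      - ((2 * (1 - scalarPart (transportStep W 1 p)) * scalarPart (hol 1 p) + 2 * (vecPart (transportStep W 1 p) ⬝ᵥ vecPart (hol 1 p)))
        - 2 * ∑ c, covCurl 1 (linkVec L W) (p, c) * plaqCurv 1 (p, c) - scalarPart (hol 1 p) * ∑ c, covCurl 1 (linkVec L W) (p, c) ^ 2))|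
        ≤ ∑ _p : Plaquette 3 L, (1728 * τ ^ 2 * Real.sqrt σ + σ / 2 * (29376 * τ ^ 3 + 700569 * τ ^ 4) + 700000 * t * τ ^ 3) :=
          Finset.sum_le_sum fun p _ => key p
      _ = (Fintype.card (Plaquette 3 L) : ℝ) * (1728 * τ ^ 2 * Real.sqrt σ + σ / 2 * (29376 * τ ^ 3 + 700569 * τ ^ 4) + 700000 * t * τ ^ 3) := by
          rw [Finset.sum_const, Finset.card_univ, nsmul_eq_mul]
  -- the summed second difference is the difference of the two valley-grade remainders
  have hE : ∑ p : Plaquette 3 L,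
      (((2 * (1 - scalarPart (transportStep W U p)) * scalarPart (hol U p) + 2 * (vecPart (transportStep W U p) ⬝ᵥ vecPart (hol U p)))
        - 2 * ∑ c, covCurl U (linkVec L W) (p, c) * plaqCurv U (p, c) - scalarPart (hol U p) * ∑ c, covCurl U (linkVec L W) (p, c) ^ 2)
      - ((2 * (1 - scalarPart (transportStep W 1 p)) * scalarPart (hol 1 p) + 2 * (vecPart (transportStep W 1 p) ⬝ᵥ vecPart (hol 1 p)))
        - 2 * ∑ c, covCurl 1 (linkVec L W) (p, c) * plaqCurv 1 (p, c) - scalarPart (hol 1 p) * ∑ c, covCurl 1 (linkVec L W) (p, c) ^ 2)) =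
      (wilsonAction su2Rep (W * U) - wilsonAction su2Rep U - 2 * ∑ p : Plaquette 3 L, ∑ c, covCurl U (linkVec L W) (p, c) * plaqCurv U (p, c)
        - ∑ p : Plaquette 3 L, scalarPart (hol U p) * ∑ c, covCurl U (linkVec L W) (p, c) ^ 2) -
      (wilsonAction su2Rep (W * 1) - wilsonAction su2Rep (1 : GaugeConfig 3 L SU2)
        - 2 * ∑ p : Plaquette 3 L, ∑ c, covCurl (1 : GaugeConfig 3 L SU2) (linkVec L W) (p, c) * plaqCurv 1 (p, c)
        - ∑ p : Plaquette 3 L, scalarPart (hol (1 : GaugeConfig 3 L SU2) p) * ∑ c, covCurl (1 : GaugeConfig 3 L SU2) (linkVec L W) (p, c) ^ 2) := by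
    rw [hincU, hinc1, Finset.mul_sum, Finset.mul_sum]
    simp only [Finset.sum_sub_distrib]
  -- assemble
  have hgoal : (wilsonAction su2Rep (orthoTube L u v) - (L : ℝ) ^ 3 * wilsonAction su2Rep u - ‖covCurl (constLift L u) (linkEmbed L v)‖ ^ 2) -
        (wilsonAction su2Rep (orthoTube L 1 v) - ‖covCurl (1 : GaugeConfig 3 L SU2) (linkEmbed L v)‖ ^ 2) =
      ((wilsonAction su2Rep (W * U) - wilsonAction su2Rep U - 2 * ∑ p : Plaquette 3 L, ∑ c, covCurl U (linkVec L W) (p, c) * plaqCurv U (p, c)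
        - ∑ p : Plaquette 3 L, scalarPart (hol U p) * ∑ c, covCurl U (linkVec L W) (p, c) ^ 2) -
      (wilsonAction su2Rep (W * 1) - wilsonAction su2Rep (1 : GaugeConfig 3 L SU2)
        - 2 * ∑ p : Plaquette 3 L, ∑ c, covCurl (1 : GaugeConfig 3 L SU2) (linkVec L W) (p, c) * plaqCurv 1 (p, c)
        - ∑ p : Plaquette 3 L, scalarPart (hol (1 : GaugeConfig 3 L SU2) p) * ∑ c, covCurl (1 : GaugeConfig 3 L SU2) (linkVec L W) (p, c) ^ 2)) +
      (∑ p : Plaquette 3 L, scalarPart (hol U p) * ∑ c, covCurl U (linkVec L W) (p, c) ^ 2 - ‖covCurl U (linkVec L W)‖ ^ 2) := by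
    rw [hTu, hT1, hSU, hS1, hlinU, hlin1, hw1, hWv, ← hU]
    ring
  rw [hgoal, ← hE]
  refine (abs_add_le _ _).trans ?_
  have hlast : |∑ p : Plaquette 3 L, scalarPart (hol U p) * ∑ c, covCurl U (linkVec L W) (p, c) ^ 2 - ‖covCurl U (linkVec L W)‖ ^ 2| ≤
      σ / 2 * ‖covCurl U (linkEmbed L v)‖ ^ 2 := by
    rw [hWv] at hwU ⊢
    rw [abs_le]; constructor <;> nlinarith [hwU.1, hwU.2, sq_nonneg ‖covCurl U (linkEmbed L v)‖]
  linarith [hsum, hlast]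

end Summit.QuantumFields.YangMills.Theorems.FemtoTransferGap.RateTube

end
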